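/-
Copyright: statement-level skeleton of a published paper (lit-balaban cell, reader/typer r15). No proof claims beyond
what the kernel checks below.
-/
import Literature.MathematicalPhysics.QuantumFieldTheory.BalabanImbrieJaffe1984to88.BIJ85CellAverages

/-!
# BIJ85 — T. Bałaban, J. Imbrie, A. Jaffe, *Renormalization of the Higgs model: minimizers, propagators and the
stability of mean field theory*, CMP **97** (1985) 299–329, p. 303: the two sentences after (2.9) and the axial-gauge
remark, for the COVARIANT average (2.6)

statement-level skeleton of published theorems with citation tags; proofs where landed; nothing here is a claim about
the Yang–Mills mass gap

Source: held text `paper:balaban1985-cmp97-bij-higgs-minimizers` p. 303 [PDF 5] ll. 14–24, verbatim: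
*"A further property of Q is that QQ^* = I, (2.9) where Q^* is the adjoint in the scalar product (2.2). Thus Q^* maps
functions on the a-lattice into functions on the L^{−1}a lattice. Furthermore Q^*Q is an orthogonal projection. In other
words Q is a partial isometry. … In the axial gauge, Qφ reduces to the ordinary average of φ, and Q^*Q is the projection
onto φ which are constant on blocks B(y)."*

Rows C1.Eq2.9 (clauses 2–3) and C1.Txt@303 of `HOME/lit-balaban-r15/ROWS-C1.md`.  `BIJ85CellAverages` (r15 gen 1)
proved (2.9) `Cells.Qcov_QcovStar` for the covariant average (2.6) `Cells.Qcov` (transports u(Γ_{yx}) supplied as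
`τ : F → Circle`) with its adjoint `Cells.QcovStar` (`inner_Qcov_eq_inner_QcovStar`), and the projection statement only for
the transport-free real averages (`Qstar_Q`, `P_idem`, `inner_P_symm`).  This file adds, for the covariant (2.6) itself:

* `Pcov τ φ := Q^*Qφ` with its closed form `Pcov_of_mem`: (Q^*Qφ)_x = u(Γ_{yx})^{−1}·L^{−d} Σ_{x′∈B(y)} u(Γ_{yx′})φ_{x′}
  for x ∈ B(y), 0 for x in no block;
* *"Q^*Q is an orthogonal projection"*: `Pcov_idem` (under the printed count |B(y)| = L^d) and `innerC_Pcov_symm`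
  (self-adjoint for the unit-lattice scalar product (2.2));
* *"Q is a partial isometry"*: `innerC_QcovStar_QcovStar` (Q^* is an isometry ⟨Q^*ψ, Q^*ψ′⟩₁ = ⟨ψ, ψ′⟩_L) and
  `innerC_Qcov_Qcov_eq_innerC_Pcov` (⟨Qφ, Qφ′⟩_L = ⟨φ, Q^*Qφ′⟩₁: Q is isometric on the range of the projection Q^*Q);
* the axial-gauge remark (u_b = 1 on every bond of the Γ_{yx}, i.e. τ ≡ 1): `Qcov_one` (*"Qφ reduces to the ordinary
  average of φ"*), `Pcov_one_of_mem` (Q^*Qφ = the block mean), `Pcov_one_blockConst` (its values are constant on blocks)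
  and `Pcov_one_eq_self_of_blockConst` (it fixes every φ constant on blocks, when every site lies in a block) — *"Q^*Q is
  the projection onto φ which are constant on blocks B(y)"*.

All statements are over the abstract cell carrier `BIJ85CellAverages.Cells` (sites: m = 0 is not needed — (2.6) carries
the weight L^{−d} itself); the torus instances are r18's `BIJ85BlockAveragesTorus.torusCells` (`qCov_eq_cellsQcov`).
Theorems only (+ one abbreviation-style definition `Pcov` with body); no hypotheses beyond the printed count.
-/

open scoped BigOperators ComplexConjugate

namespace Literature.MathematicalPhysics.QuantumFieldTheory.BalabanImbrieJaffe1984to88.BIJ85Eq29Projection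

open BIJ85CellAverages BIJ85CellAverages.Cells

variable (G : Cells)

/-- The operator Q^*Q of p. 303 for the covariant average (2.6): `Pcov τ φ := Q^*(Qφ)` (*"Furthermore Q^*Q is an
orthogonal projection"*). [cite: BalabanImbrieJaffe1985, (2.9) p.303] -/
noncomputable def Pcov (τ : G.F → Circle) (φ : G.F → ℂ) : G.F → ℂ :=
  G.QcovStar τ (G.Qcov τ φ)

/-- kernel: Q^*Qφ = `Pcov` (definitional). [cite: BalabanImbrieJaffe1985, (2.9) p.303] -/
theorem QcovStar_Qcov (τ : G.F → Circle) (φ : G.F → ℂ) : G.QcovStar τ (G.Qcov τ φ) = Pcov G τ φ := rfl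

/-- kernel: closed form of Q^* on a block — (Q^*ψ)_x = u(Γ_{yx})^{−1}ψ_y for x ∈ B(y).
[cite: BalabanImbrieJaffe1985, (2.9) p.303] -/
theorem QcovStar_of_mem (τ : G.F → Circle) (ψ : G.C → ℂ) {x : G.F} {y : G.C} (h : x ∈ G.B y) :
    G.QcovStar τ ψ x = (((τ x)⁻¹ : Circle) : ℂ) * ψ y := by
  classical
  unfold Cells.QcovStar
  rw [Finset.sum_eq_single y]
  · simp [h]
  · intro y' _ hne
    have : x ∉ G.B y' := fun h' => hne (G.B_unique h' h)
    simp [this]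
  · intro hy
    exact absurd (Finset.mem_univ y) hy

/-- kernel: (Q^*ψ)_x = 0 for x in no block. [cite: BalabanImbrieJaffe1985, (2.9) p.303] -/
theorem QcovStar_of_not_mem (τ : G.F → Circle) (ψ : G.C → ℂ) {x : G.F} (h : ∀ y, x ∉ G.B y) :
    G.QcovStar τ ψ x = 0 := by
  unfold Cells.QcovStar
  exact Finset.sum_eq_zero fun y _ => by simp [h y]

/-- kernel: closed form of Q^*Q on a block — (Q^*Qφ)_x = u(Γ_{yx})^{−1}·L^{−d} Σ_{x′∈B(y)} u(Γ_{yx′})φ_{x′} for x ∈ B(y).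
[cite: BalabanImbrieJaffe1985, (2.9) p.303] -/
theorem Pcov_of_mem (τ : G.F → Circle) (φ : G.F → ℂ) {x : G.F} {y : G.C} (h : x ∈ G.B y) :
    Pcov G τ φ x = (((τ x)⁻¹ : Circle) : ℂ) * (((G.L : ℂ) ^ G.d)⁻¹ * ∑ x' ∈ G.B y, (τ x' : ℂ) * φ x') := by
  rw [Pcov, QcovStar_of_mem G τ _ h]
  rfl

/-- kernel: (Q^*Qφ)_x = 0 for x in no block. [cite: BalabanImbrieJaffe1985, (2.9) p.303] -/
theorem Pcov_of_not_mem (τ : G.F → Circle) (φ : G.F → ℂ) {x : G.F} (h : ∀ y, x ∉ G.B y) : Pcov G τ φ x = 0 :=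
  QcovStar_of_not_mem G τ _ h

/-- **p. 303, after (2.9)**: *"Furthermore Q^*Q is an orthogonal projection"* — idempotence: (Q^*Q)(Q^*Q) = Q^*(QQ^*)Q = Q^*Q
by (2.9), under the printed count |B(y)| = L^d. [cite: BalabanImbrieJaffe1985, (2.9) p.303] -/
theorem Pcov_idem (hcard : ∀ y : G.C, (G.B y).card = G.L ^ G.d) (τ : G.F → Circle) (φ : G.F → ℂ) :
    Pcov G τ (Pcov G τ φ) = Pcov G τ φ := by
  unfold Pcov
  congr 1
  funext y
  exact G.Qcov_QcovStar hcard τ _ y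

/-- kernel: conjugate symmetry of the scalar product (2.2) for a real weight: conj ⟨φ, φ′⟩_w = ⟨φ′, φ⟩_w.
[cite: BalabanImbrieJaffe1985, (2.2) p.302] -/
theorem conj_innerC {X : Type} [Fintype X] (w : ℂ) (hw : conj w = w) (φ φ' : X → ℂ) :
    conj (innerC w φ φ') = innerC w φ' φ := by
  unfold innerC
  rw [map_sum]
  refine Finset.sum_congr rfl fun x _ => ?_
  rw [map_mul, map_mul, hw, RingHomCompTriple.comp_apply, RingHom.id_apply]
  ring

/-- kernel: ⟨Qφ, Qφ′⟩_L = ⟨φ, Q^*Qφ′⟩₁ — Q is isometric on the range of Q^*Q (adjointness `inner_Qcov_eq_inner_QcovStar`).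
[cite: BalabanImbrieJaffe1985, (2.9) p.303] -/
theorem innerC_Qcov_Qcov_eq_innerC_Pcov (τ : G.F → Circle) (φ φ' : G.F → ℂ) :
    innerC ((G.L : ℂ) ^ G.d) (G.Qcov τ φ) (G.Qcov τ φ') = innerC 1 φ (Pcov G τ φ') :=
  G.inner_Qcov_eq_inner_QcovStar τ φ _

/-- **p. 303, after (2.9)**: *"Furthermore Q^*Q is an orthogonal projection"* — self-adjointness of Q^*Q for the unit-lattice
scalar product (2.2): ⟨Q^*Qφ, φ′⟩₁ = ⟨φ, Q^*Qφ′⟩₁ (both equal ⟨Qφ, Qφ′⟩_L). [cite: BalabanImbrieJaffe1985, (2.9) p.303] -/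
theorem innerC_Pcov_symm (τ : G.F → Circle) (φ φ' : G.F → ℂ) :
    innerC 1 (Pcov G τ φ) φ' = innerC 1 φ (Pcov G τ φ') := by
  have h1 : innerC 1 φ (Pcov G τ φ') = innerC ((G.L : ℂ) ^ G.d) (G.Qcov τ φ) (G.Qcov τ φ') :=
    (innerC_Qcov_Qcov_eq_innerC_Pcov G τ φ φ').symm
  have h2 : innerC 1 φ' (Pcov G τ φ) = innerC ((G.L : ℂ) ^ G.d) (G.Qcov τ φ') (G.Qcov τ φ) :=
    (innerC_Qcov_Qcov_eq_innerC_Pcov G τ φ' φ).symm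
  have hw : conj ((G.L : ℂ) ^ G.d) = (G.L : ℂ) ^ G.d := by rw [map_pow, map_natCast]
  rw [← conj_innerC 1 (map_one _) φ' (Pcov G τ φ), h2, conj_innerC _ hw, h1]

/-- **p. 303, after (2.9)**: *"In other words Q is a partial isometry"* — Q^* is an isometry from the L-lattice scalar
product to the unit-lattice one: ⟨Q^*ψ, Q^*ψ′⟩₁ = ⟨QQ^*ψ, ψ′⟩_L = ⟨ψ, ψ′⟩_L by (2.9), under the printed count |B(y)| = L^d.
[cite: BalabanImbrieJaffe1985, (2.9) p.303] -/
theorem innerC_QcovStar_QcovStar (hcard : ∀ y : G.C, (G.B y).card = G.L ^ G.d) (τ : G.F → Circle)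
    (ψ ψ' : G.C → ℂ) :
    innerC 1 (G.QcovStar τ ψ) (G.QcovStar τ ψ') = innerC ((G.L : ℂ) ^ G.d) ψ ψ' := by
  rw [← G.inner_Qcov_eq_inner_QcovStar τ (G.QcovStar τ ψ) ψ']
  unfold innerC
  refine Finset.sum_congr rfl fun y _ => ?_
  rw [G.Qcov_QcovStar hcard τ ψ y]

/-- kernel: Q^*Q annihilates exactly what Q annihilates — Q(Q^*Qφ) = Qφ (by (2.9)), so Q^*Qφ = 0 ↔ Qφ = 0.
[cite: BalabanImbrieJaffe1985, (2.9) p.303] -/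
theorem Qcov_Pcov (hcard : ∀ y : G.C, (G.B y).card = G.L ^ G.d) (τ : G.F → Circle) (φ : G.F → ℂ) :
    G.Qcov τ (Pcov G τ φ) = G.Qcov τ φ := by
  funext y
  exact G.Qcov_QcovStar hcard τ _ y

/-! ### The axial-gauge remark p. 303: u_b = 1 on every bond of the Γ_{yx}, i.e. u(Γ_{yx}) = 1 (`τ = 1`) -/

/-- **p. 303**: *"In the axial gauge, Qφ reduces to the ordinary average of φ"* — with u(Γ_{yx}) = 1 for all x ∈ B(y)
(axial gauge: *"we choose h in order to set u_b = 1 for every b which occurs in some Γ_{yx}"*), (2.6) is the block mean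
(Qφ)_y = L^{−d} Σ_{x∈B(y)} φ_x. [cite: BalabanImbrieJaffe1985, (2.6) p.303] -/
theorem Qcov_one (φ : G.F → ℂ) (y : G.C) : G.Qcov 1 φ y = ((G.L : ℂ) ^ G.d)⁻¹ * ∑ x ∈ G.B y, φ x := by
  unfold Cells.Qcov
  simp

/-- **p. 303**: *"and Q^*Q is the projection onto φ which are constant on blocks B(y)"* — in the axial gauge (τ = 1),
(Q^*Qφ)_x = L^{−d} Σ_{x′∈B(y)} φ_{x′} = the mean of φ over the block B(y) ∋ x. [cite: BalabanImbrieJaffe1985, (2.9) p.303] -/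
theorem Pcov_one_of_mem (φ : G.F → ℂ) {x : G.F} {y : G.C} (h : x ∈ G.B y) :
    Pcov G 1 φ x = ((G.L : ℂ) ^ G.d)⁻¹ * ∑ x' ∈ G.B y, φ x' := by
  rw [Pcov_of_mem G 1 φ h]
  simp

/-- kernel: in the axial gauge the values of Q^*Qφ are constant on each block B(y) (the range of the projection consists of
block-constant functions, zero off the blocks). [cite: BalabanImbrieJaffe1985, (2.9) p.303] -/
theorem Pcov_one_blockConst (φ : G.F → ℂ) {x x' : G.F} {y : G.C} (hx : x ∈ G.B y) (hx' : x' ∈ G.B y) :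
    Pcov G 1 φ x = Pcov G 1 φ x' := by
  rw [Pcov_one_of_mem G φ hx, Pcov_one_of_mem G φ hx']

/-- **p. 303**: *"Q^*Q is the projection onto φ which are constant on blocks B(y)"* — in the axial gauge Q^*Q FIXES every φ
that is constant on each block, when every site lies in some block (sites of T₁: *"Let B(y) denote the sites x of T₁
with distance to y less than L/2"*, p. 302) and |B(y)| = L^d. [cite: BalabanImbrieJaffe1985, (2.9) p.303] -/
theorem Pcov_one_eq_self_of_blockConst (hcard : ∀ y : G.C, (G.B y).card = G.L ^ G.d)
    (hcover : ∀ x : G.F, ∃ y : G.C, x ∈ G.B y) (φ : G.F → ℂ)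
    (hφ : ∀ (y : G.C) (x x' : G.F), x ∈ G.B y → x' ∈ G.B y → φ x = φ x') :
    Pcov G 1 φ = φ := by
  have hL : (G.L : ℂ) ^ G.d ≠ 0 :=
    pow_ne_zero _ (Nat.cast_ne_zero.mpr (by have := G.one_le_L; omega))
  funext x
  obtain ⟨y, hx⟩ := hcover x
  rw [Pcov_one_of_mem G φ hx]
  have h1 : ∑ x' ∈ G.B y, φ x' = ∑ x' ∈ G.B y, φ x := Finset.sum_congr rfl fun x' hx' => hφ y x' x hx' hx
  rw [h1, Finset.sum_const, hcard, nsmul_eq_mul]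
  push_cast
  rw [← mul_assoc, inv_mul_cancel₀ hL, one_mul]

/-- kernel, summary of the axial-gauge remark: with every site in a block of L^d sites, φ is fixed by Q^*Q (τ = 1) iff φ is
constant on blocks. [cite: BalabanImbrieJaffe1985, (2.9) p.303] -/
theorem Pcov_one_eq_self_iff (hcard : ∀ y : G.C, (G.B y).card = G.L ^ G.d)
    (hcover : ∀ x : G.F, ∃ y : G.C, x ∈ G.B y) (φ : G.F → ℂ) :
    Pcov G 1 φ = φ ↔ ∀ (y : G.C) (x x' : G.F), x ∈ G.B y → x' ∈ G.B y → φ x = φ x' := by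
  constructor
  · intro h y x x' hx hx'
    rw [← h]
    exact Pcov_one_blockConst G φ hx hx'
  · exact Pcov_one_eq_self_of_blockConst G hcard hcover φ

end Literature.MathematicalPhysics.QuantumFieldTheory.BalabanImbrieJaffe1984to88.BIJ85Eq29Projection
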